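import Mathlib.RingTheory.AdjoinRoot
import Mathlib.RingTheory.KrullDimension.Basic
import Mathlib.RingTheory.RegularLocalRing.Defs
import Mathlib.RingTheory.Nilpotent.Defs
import Literature.AlgebraicGeometry.Resolution.QuadraticTransforms
import Literature.AlgebraicGeometry.Resolution.ExcellentRings
import HarnessLib

/-!
# Cossart–Piltant's Hironaka-local uniformization of purely inseparable threefold hypersurface
# germs (J. Algebra 529 (2019), Thm. 1.4 (i)), branch-local form: along a zero-dimensional
# valuation, a branch of ISOLATED singular point blowing-ups of `X^p − f` over an excellent
# regular three-dimensional local ring reaches a regular local ring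

Topic: `Literature/AlgebraicGeometry/Resolution`. NAMED FACT (prover-filed mid-proof, D-0014 «NEED A
PUBLISHED FACT»; cell `res-hironaka`, rung L, slot W4.1 — the «K(3) input» of the crux chain on `Steer`,
`stmt-ResolutionOfSingularities-16345`: the codimension-three piece (`c = 3`) of res-L0-w41-idea-1's
codimension split `NoEternalIsolatedRadicandChain p c`, card `generic-point-forcing`; the consumer
`NoEternalChainThree.noEternalIsolatedRadicandChain_three` takes `(hCP : CossartPiltant2019HironakaLUIsolatedBranch)`).
Sibling of `LipmanNoEternalNormalBranch.lean` (the `c = 2` input, Lipman 1978 followed along a branch) and of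
the WEAK (Zariski-style: «some finitely generated extension is regular at the centre») renderings of the same
paper's local theorems in `ArithmeticalThreefoldsLocal*.lean` (`CossartPiltant2019Local`,
`CossartPiltant2019_localUniformization_multiplicityEq`, …), which do NOT pin the blowing-up sequence and
therefore cannot serve a «no eternal branch» consumer. THIS file renders the STRONG (Hironaka) form of
Theorem 1.4 (i), followed along one branch of closed points at which the singularity is isolated.

## What the source prints (arXiv:1412.0868v1 = the J. Algebra 529 (2019) text; pages read 2026-08-27 from the
## held copy `paper:arxiv-1412.0868`)

NUMBERING NOTE (res-lit-6 custody, res-L0-w41-plan-1 RULING 10): the held text is arXiv **v1** (Dec. 2014); in the published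
J. Algebra 529 (2019) text (= arXiv v2) the same items are numbered **Theorem 1.5** (v1: Theorem 1.4), **Definition 2.20–2.21**
(v1: Definition 2.7) and **Proposition 2.22** (v1: Proposition 2.7); page/line anchors below refer to the v1 file. The printed-shape
(permissible-tower) rendering of the same theorem is `CossartPiltant2019LocalPermissible` (`ArithmeticalThreefoldsLocalPermissible.lean`,
res-type-026), which implies this branch-local form (`Summit…Theorems.SwitchingDichotomy.HironakaLUBranchOfCP.hironakaLUIsolatedBranch_of_localPermissible`).

* p. 4, **Theorem 1.4**, VERBATIM: «Let `(S, m_S, k)` be an excellent regular local ring of dimension `n = 3`,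
  quotient field `K := QF(S)` and residue characteristic `char k = p > 0`. Let
  `h := X^p + f_1 X^{p-1} + ⋯ + f_p ∈ S[X]`, `f_1, …, f_p ∈ S` be a reduced polynomial,
  `𝒳 := Spec(S[X]/(h))` and `L := Tot(S[X]/(h))` be its total quotient ring. Assume that `h` satisfies one
  of the following assumptions: (i) `char K = p` and `f_1 = ⋯ = f_{p-1} = 0`, or (ii) `𝒳` is `G`-invariant,
  where `G := Aut_K(L) = ℤ/p`. Let `μ` be a valuation of `L` which is centered in `m_S`. There exists a
  composition of local Hironaka-permissible blowing ups
  `(𝒳 =: 𝒳_0, x_0) ← (𝒳_1, x_1) ← ⋯ ← (𝒳_r, x_r)`, where `x_i ∈ 𝒳_i` is the center of `μ`, such that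
  `(𝒳_r, x_r)` is regular.» — and, same page: «No other assumption on `S` is required here than excellence
  of `S`; we do not even assume that `[k : k^p] < +∞`».
* p. 9: «Given a point `y ∈ 𝒳`, its residue field is denoted by `k(y)` and its multiplicity by `m(y)`.
  Explicitly, we have: `m(y) = ord_{m_{S[X]_y}} h`. The singular locus of `𝒳` is denoted by:
  `Sing 𝒳 = {y ∈ 𝒳 : m(y) ≥ 2}`.»
* p. 14, **Definition 2.7**: «Let `𝒴 ⊂ 𝒳` be an integral closed subscheme with generic point `y`. We say that
  `𝒴` is Hironaka-permissible (resp. … with respect to `E`) at `x ∈ 𝒴` if condition (i) (resp. condition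
  (ii)) below is satisfied: (i) `m(y) = m(x)` and `𝒴` regular at `x`; (ii) `𝒴 ⊆ Sing_m 𝒳` and `W := η(𝒴)`
  has normal crossings with `E` at `s := η(x)`.» and «By a local Hironaka-permissible blowing up, we simply
  mean the localization at some point of the exceptional divisor `π⁻¹(𝒴)` of the blowing up `π` along a
  Hironaka-permissible center.»
* pp. 14–15, **Proposition 2.7**: under a Hironaka-permissible blowing up at `x`, the base `Spec S` is blown
  up along `W = η(𝒴)`; for `s' ∈ σ⁻¹(s)`, `S' := 𝒪_{𝒮',s'}`, «there exists `h' ∈ S'[X']` unitary of degree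
  `m` such that `𝒳'_{s'} = Spec(S'[X']/(h'))`», explicitly (proof) `X' := Z/u_{j₀}`, `Z = X − θ` (`θ ∈ S`),
  `u_{j₀}` a local equation of the exceptional divisor, and `h' := u_{j₀}^{-m} h(Z) = X'^m + ⋯ + u_{j₀}^{-m} f_{m,Z}`;
  for `h = X^p − f` in characteristic `p` this reads `h(Z) = Z^p − (f − θ^p)` and
  `h' = X'^p − u_{j₀}^{-p}(f − θ^p)`.
* p. 3: «We remark at this point that the morphism `π` in theorem 1.1 is not constructed as a composition of
  Hironaka-permissible blowing ups … On the other hand, a certain local version of theorem 1.1 is proved using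
  only local Hironaka-permissible blowing ups in theorem 1.4 below.»

## Print placement of the branch-local form below (why it is WEAKER than Theorem 1.4 (i))

Data: a field `K` of characteristic `p` (case (i)), a valuation ring `O` of `K`, a sequence `S : ℕ → Subring K`
of excellent regular local rings of dimension three with `S 0` dominated by `O` and every `S (i+1)` the quadratic
transform of `S i` ALONG `O` (`IsQuadraticTransformAlong`, Cutkosky §2.2 / Novacoski–Spivakovsky Def. 2.11:
the local ring of the blowing-up of the closed point of `Spec (S i)` at the centre of `O`; keeping dimension three
means that every centre is a closed point, i.e. `O` is zero-dimensional on the tower), an exceptional parameter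
`u i` (`m_{S i} · S (i+1) = (u i)`), radicands `f i ∈ S i` and cleaners `θ i ∈ S i` with
`f (i+1) · (u i)^p = f i − (θ i)^p`, the germ `X^p − f 0` reduced, and — the special-case hypothesis — every
torsor germ `T i := (S i)[X]/(X^p − f i)` (a local ring, finite purely inseparable over `S i`) with an ISOLATED
singularity: each non-maximal prime of `T i` has a regular local ring. Let `μ` be the unique extension to the
purely inseparable extension `L = K[X]/(X^p − f 0)` of the valuation of `K` with ring `O`; it is centred in
`m_{S 0}`. Theorem 1.4 (i) gives a composition of local Hironaka-permissible blowing ups along `μ` ending at a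
regular `(𝒳_r, x_r)`. CLAIM: as long as `(𝒳_i, x_i)` is singular, `(𝒳_i, x_i) = Spec (T i)` and the
`(i+1)`-st centre is the closed point `x_i`. Indeed if `𝒴 ∋ x_i` is Hironaka-permissible at `x_i` with generic
point `y`, then `m(y) = m(x_i) ≥ 2` (Def. 2.7 (i); `x_i` is singular), so `𝒪_{𝒳_i,y} = S_i[X]_y/(h_i)` is
not regular (`ord h_i ≥ 2`), and `y` is a non-maximal point of the local scheme `Spec (T i)` unless `y = x_i`;
isolatedness forces `y = x_i`, i.e. `𝒴 = {x_i}`. The local blowing up of the closed point along `μ` is computed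
by Prop. 2.7 with `W = {m_{S i}}`: its base is the local ring of `Bl_{m}(Spec S i)` at the centre of `μ|_K = O`,
which is `S (i+1)`, and its equation is `X'^p − u^{-p}(f i − θ^p) = X'^p − f (i+1)` (two cleaners `θ, θ̃`
with both quotients in `S (i+1)` differ by `u · s`, `s ∈ S (i+1)`, by normality of `S (i+1)`, so the presentations
are isomorphic; two exceptional parameters differ by a unit of `S (i+1)`). Hence either some `T i` with `i < r`
is already regular, or `(𝒳_r, x_r) = Spec (T r)` is regular: in both cases SOME `T r` is regular — the
conclusion below. Weaker than print: case (i) only, zero-dimensional valuations only, isolated singularities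
along the branch only (positive-dimensional Hironaka-permissible centres never occur), conclusion «some member
regular» instead of the explicit composition. NOT in print and NOT claimed here: anything about branches with
non-isolated members, any global statement (Thm. 1.1's `π` is not by Hironaka-permissible blowing ups, p. 3).

-- TODO(general form): Theorem 1.4 for arbitrary valuations `μ` (positive-dimensional centres of `μ|_K`) and
-- with positive-dimensional Hironaka-permissible centres — needs the multiplicity function `m(y)` of
-- `S[X]/(h)` (order of `h` at primes of `S[X]`) and blowing ups of regular non-maximal centres in the tree;
-- case (ii) (`G`-invariant, residue characteristic `p`, `char K` arbitrary).

References: V. Cossart, O. Piltant, *Resolution of singularities of arithmetical threefolds*, J. Algebra 529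
(2019) 268–535 (= arXiv:1412.0868), Thm. 1.4, Def. 2.7, Prop. 2.7 [CossartPiltant2019]; S. D. Cutkosky,
*A counterexample to strong local monomialization in a tower of two algebraic extensions* (2014), §2.1–2.2
(quadratic transforms along a valuation, the tree's `QuadraticTransforms.lean`) [Cutkosky2014].
-/

noncomputable section

namespace Literature.AlgebraicGeometry.Resolution

open Polynomial IsLocalRing

universe u

/-- NAMED FACT — **Cossart–Piltant 2019, Theorem 1.4 (i), followed along a branch of isolated singular
closed points: over an excellent regular three-dimensional local ring of characteristic `p`, the branch of
point blowing-ups of a reduced purely inseparable hypersurface germ `X^p − f` along a zero-dimensional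
valuation, all of whose members have isolated singularity, contains a REGULAR member** (Thm. 1.4 (i) p. 4:
along any valuation `μ` centred in `m_S` a composition of local Hironaka-permissible blowing ups
`(𝒳_0,x_0) ← ⋯ ← (𝒳_r,x_r)`, `x_i` the centre of `μ`, reaches a regular `(𝒳_r,x_r)`; Def. 2.7 (i) p. 14:
a Hironaka-permissible centre `𝒴 ∋ x` has `m(y) = m(x)`, so at an ISOLATED singular point the only one is
the closed point; Prop. 2.7 pp. 14–15: the point blowing-up has base the quadratic transform `S'` of the
base and equation `X'^p − u^{-p}(f − θ^p)`).  Data, base-side inside one field `K` of characteristic `p`: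
`O` a valuation ring of `K`; `S : ℕ → Subring K` excellent regular local rings of Krull dimension `3`
(zero-dimensional branch), `S 0` dominated by `O`, each `S (i+1)` the quadratic transform of `S i` ALONG
`O` (`IsQuadraticTransformAlong`); `u i` generating `m_{S i} · S (i+1)`; radicands and cleaners
`f i, θ i ∈ S i` with `f (i+1) · (u i)^p = f i − (θ i)^p`; the germ `(S 0)[X]/(X^p − f 0)` reduced
(`h` reduced); every germ `(S i)[X]/(X^p − f i)` (`AdjoinRoot`) with isolated singularity (every
non-maximal prime has a regular local ring).  Conclusion: some `(S r)[X]/(X^p − f r)` is a regular local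
ring.  The reduction of this branch-local special case to the printed theorem is the paragraph «Print
placement» of the module docstring.  Weaker than print (case (i); zero-dimensional valuations; isolated
singularities along the branch; existence of a regular member only).  Users take
`(h : CossartPiltant2019HironakaLUIsolatedBranch)`.
[cite: CossartPiltant2019, Thm. 1.5 (i) (arXiv v1: Thm. 1.4, p. 4), Def. 2.20–2.21 (v1: Def. 2.7 (i)) and Prop. 2.22 (v1: Prop. 2.7, pp. 14–15), p. 9 (m(y)), p. 3]
[cite: Cutkosky2014, §2.2] -/
def CossartPiltant2019HironakaLUIsolatedBranch : Prop :=
  ∀ (p : ℕ), p.Prime → ∀ (K : Type u) [Field K] [CharP K p] (O : ValuationSubring K)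
    (S : ℕ → Subring K) [∀ i, IsLocalRing (S i)] (hle : ∀ i, S i ≤ S (i + 1))
    (f θ : ∀ i, S i) (u : ∀ i, S (i + 1)),
    (∀ i, IsRegularLocalRing (S i)) → (∀ i, IsExcellentRing (S i)) →
    (∀ i, ringKrullDim (S i) = (3 : ℕ)) →
    SubringDominates (S 0) O.toSubring →
    (∀ i, IsQuadraticTransformAlong O (S i) (S (i + 1))) →
    (∀ i, Ideal.span ((fun y : S i => (⟨(y : K), hle i y.2⟩ : S (i + 1))) ''
        (maximalIdeal (S i) : Set (S i))) = Ideal.span {u i}) →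
    (∀ i, ((f (i + 1) : S (i + 1)) : K) * ((u i : S (i + 1)) : K) ^ p =
        ((f i : S i) : K) - ((θ i : S i) : K) ^ p) →
    IsReduced (AdjoinRoot ((X : (S 0)[X]) ^ p - C (f 0))) →
    (∀ i, ∀ (P : Ideal (AdjoinRoot ((X : (S i)[X]) ^ p - C (f i)))) [P.IsPrime],
        (∃ Q : Ideal (AdjoinRoot ((X : (S i)[X]) ^ p - C (f i))), Q.IsPrime ∧ P < Q) →
        IsRegularLocalRing (Localization.AtPrime P)) →
    ∃ r, IsRegularLocalRing (AdjoinRoot ((X : (S r)[X]) ^ p - C (f r)))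

end Literature.AlgebraicGeometry.Resolution

end
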